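import Mathlib.Data.Int.Basic
import Mathlib.Data.Nat.Basic
import HarnessLib

/-!
# Kernel-checkable class-group certificates for cyclic quintic orders: the checker

Topic `NumberTheory/NumberFields`. Pure `ℕ`/`ℤ` arithmetic written with the raw kernel-accelerated
primitives (`Nat.add`, `Nat.mul`, `Nat.mod`, `Nat.land`, …; no type-class arithmetic, no `Finset`,
no `ZMod`), to be evaluated by `decide +kernel` on packed certificate data. The soundness theorems
connecting it to the orders `TAlg spec ℤ ≅ 𝓞 K` of the quintic fields of conductor `2651` live in
`QuinticCertSound.lean` and the per-field `CyclicQuinticField2651K*ClassGroup.lean`. This file only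
DEFINES the checker. [folklore]

## What is checked (see `FieldData.checkRange`)

For every prime `p` in a range (composites are skipped by an in-kernel sieve mask):
* `p ∈ {11, 241, p₀}` (ramified primes, generator prime): skipped here (treated separately);
* if the next record is for `p` (a SPLIT prime): the record supplies one ring homomorphism
  `h : Λ → ℤ/p` (from a root `r` by `g_b ↦ P_b(r)/D`, or explicitly when `p ∣ D`), verified on the
  multiplication table, with pairwise distinct rotations (so its five rotations are all the
  homomorphisms), a homomorphism `h5 : Λ → ℤ/p⁵` reducing to it (Hensel, verified on the table) and an
  element `β ∈ Λ` with `N(β) = ± p⁵ · 11ᵃ · 241ᵇ` lying in `ker(h5 ∘ σ⁻ᵏ)` after `k` shifts, for all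
  `k < 5` (so the fifth power of every prime above `p` is principal up to the primes above `11, 241`);
* otherwise (`p` NON-SPLIT): an inverse of `t^p - t` in `𝔽_p[t]/(f̄)` (so `f̄` has no root), and when
  `p² ≤ M` also an inverse of `t^{p²} - t` (so `f̄` is irreducible, Rabin).
## References

* H. Cohen, *A Course in Computational Algebraic Number Theory*, GTM 138 (1993), §4.9, §6.5. [folklore]
* M. O. Rabin, SIAM J. Comput. 9 (1980) (roots and irreducibility via `t^p - t`, `t^{p²} - t`). [folklore]
-/

namespace Literature.NumberTheory.NumberFields

namespace QuinticCert

/-! ### Raw integer helpers -/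

/-- Boolean equality of integers by constructors. [folklore] -/
def ibeq : ℤ → ℤ → Bool
  | Int.ofNat m, Int.ofNat n => Nat.beq m n
  | Int.negSucc m, Int.negSucc n => Nat.beq m n
  | _, _ => false

/-- Residue of an integer modulo `m > 0`, in `ℕ`. [folklore] -/
def ires (a : ℤ) (m : ℕ) : ℕ := Int.toNat (Int.emod a (Int.ofNat m))

/-! ### Integer quintuples (elements of the order on its normal basis) -/

/-- An element `Σ uₐ gₐ` of the order, by its five integer coordinates. [folklore] -/
structure Z5 where
  /-- coordinate -/ c0 : ℤ
  /-- coordinate -/ c1 : ℤ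
  /-- coordinate -/ c2 : ℤ
  /-- coordinate -/ c3 : ℤ
  /-- coordinate -/ c4 : ℤ

namespace Z5

/-- The Galois shift `g_b ↦ g_{b+1}` on coordinates: `(shift u)_a = u_{a-1}`. [folklore] -/
def shift (u : Z5) : Z5 := ⟨u.c4, u.c0, u.c1, u.c2, u.c3⟩

/-- `k`-fold shift. [folklore] -/
def shiftN : ℕ → Z5 → Z5
  | 0, u => u
  | k + 1, u => shift (shiftN k u)

/-- The norm form `u · σu · σ²u · σ³u · σ⁴u` from a multiplication. [folklore] -/
def norm (mul : Z5 → Z5 → Z5) (u : Z5) : Z5 :=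
  let u1 := u.shift
  let u2 := u1.shift
  let u3 := u2.shift
  let u4 := u3.shift
  mul (mul (mul (mul u u1) u2) u3) u4

/-- `u` is the constant `n` (all coordinates `n`, as `1 = g₀ + ⋯ + g₄`). [folklore] -/
def isConst (u : Z5) (n : ℤ) : Bool :=
  ibeq u.c0 n && ibeq u.c1 n && ibeq u.c2 n && ibeq u.c3 n && ibeq u.c4 n

/-- `Σ uₐ hₐ mod m` for a residue vector `h`. [folklore] -/
def evalMod (u : Z5) (h0 h1 h2 h3 h4 : ℕ) (m : ℕ) : ℕ :=
  ires (Int.add (Int.add (Int.add (Int.add (Int.mul u.c0 (Int.ofNat h0)) (Int.mul u.c1 (Int.ofNat h1)))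
    (Int.mul u.c2 (Int.ofNat h2))) (Int.mul u.c3 (Int.ofNat h3))) (Int.mul u.c4 (Int.ofNat h4))) m

/-- The `a`-th basis vector. [folklore] -/
def basis : ℕ → Z5
  | 0 => ⟨1, 0, 0, 0, 0⟩
  | 1 => ⟨0, 1, 0, 0, 0⟩
  | 2 => ⟨0, 0, 1, 0, 0⟩
  | 3 => ⟨0, 0, 0, 1, 0⟩
  | _ => ⟨0, 0, 0, 0, 1⟩

end Z5

/-! ### Arithmetic in `𝔽_p[t]/(f̄)` on quintuples of naturals -/

/-- A residue polynomial `c₀ + c₁t + ⋯ + c₄t⁴` with natural coefficients. [folklore] -/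
structure N5 where
  /-- coefficient -/ c0 : ℕ
  /-- coefficient -/ c1 : ℕ
  /-- coefficient -/ c2 : ℕ
  /-- coefficient -/ c3 : ℕ
  /-- coefficient -/ c4 : ℕ

/-- The reduction data of a field at a prime: `p` and the residues `P₀, …, P₄` of the relation
`t⁵ = P₄t⁴ + ⋯ + P₀` (`Pᵢ ≡ -aᵢ`). [folklore] -/
structure RedData where
  /-- the modulus -/ p : ℕ
  /-- relation coefficient -/ P0 : ℕ
  /-- relation coefficient -/ P1 : ℕ
  /-- relation coefficient -/ P2 : ℕ
  /-- relation coefficient -/ P3 : ℕ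
  /-- relation coefficient -/ P4 : ℕ

namespace N5

/-- Coordinate `a`. [folklore] -/
def get (h : N5) : ℕ → ℕ
  | 0 => h.c0
  | 1 => h.c1
  | 2 => h.c2
  | 3 => h.c3
  | _ => h.c4

/-- Rotation (the homomorphism of the shifted prime). [folklore] -/
def rot (h : N5) : N5 := ⟨h.c4, h.c0, h.c1, h.c2, h.c3⟩

/-- `k`-fold rotation. [folklore] -/
def rotN : ℕ → N5 → N5
  | 0, h => h
  | k + 1, h => rot (rotN k h)

/-- The rotations of `h` are pairwise distinct (`h` is not constant). [folklore] -/
def aperiodic (h : N5) : Bool :=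
  !(Nat.beq h.c0 h.c1 && Nat.beq h.c1 h.c2 && Nat.beq h.c2 h.c3 && Nat.beq h.c3 h.c4)

/-- All coordinates are `< m` (reduced residues). [folklore] -/
def ltAll (h : N5) (m : ℕ) : Bool :=
  Nat.blt h.c0 m && Nat.blt h.c1 m && Nat.blt h.c2 m && Nat.blt h.c3 m && Nat.blt h.c4 m

/-- Product modulo `(p, t⁵ - P₄t⁴ - ⋯ - P₀)`, all arithmetic in `ℕ` with raw primitives. [folklore] -/
def mulR (d : RedData) (u v : N5) : N5 :=
  let p := d.p
  let e0 := Nat.mul u.c0 v.c0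
  let e1 := Nat.add (Nat.mul u.c0 v.c1) (Nat.mul u.c1 v.c0)
  let e2 := Nat.add (Nat.add (Nat.mul u.c0 v.c2) (Nat.mul u.c1 v.c1)) (Nat.mul u.c2 v.c0)
  let e3 := Nat.add (Nat.add (Nat.add (Nat.mul u.c0 v.c3) (Nat.mul u.c1 v.c2)) (Nat.mul u.c2 v.c1))
    (Nat.mul u.c3 v.c0)
  let e4 := Nat.add (Nat.add (Nat.add (Nat.add (Nat.mul u.c0 v.c4) (Nat.mul u.c1 v.c3)) (Nat.mul u.c2 v.c2))
    (Nat.mul u.c3 v.c1)) (Nat.mul u.c4 v.c0)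
  let e5 := Nat.add (Nat.add (Nat.add (Nat.mul u.c1 v.c4) (Nat.mul u.c2 v.c3)) (Nat.mul u.c3 v.c2))
    (Nat.mul u.c4 v.c1)
  let e6 := Nat.add (Nat.add (Nat.mul u.c2 v.c4) (Nat.mul u.c3 v.c3)) (Nat.mul u.c4 v.c2)
  let e7 := Nat.add (Nat.mul u.c3 v.c4) (Nat.mul u.c4 v.c3)
  let e8 := Nat.mod (Nat.mul u.c4 v.c4) p
  let e3 := Nat.add e3 (Nat.mul e8 d.P0)
  let e4 := Nat.add e4 (Nat.mul e8 d.P1)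
  let e5 := Nat.add e5 (Nat.mul e8 d.P2)
  let e6 := Nat.add e6 (Nat.mul e8 d.P3)
  let e7 := Nat.mod (Nat.add e7 (Nat.mul e8 d.P4)) p
  let e2 := Nat.add e2 (Nat.mul e7 d.P0)
  let e3 := Nat.add e3 (Nat.mul e7 d.P1)
  let e4 := Nat.add e4 (Nat.mul e7 d.P2)
  let e5 := Nat.add e5 (Nat.mul e7 d.P3)
  let e6 := Nat.mod (Nat.add e6 (Nat.mul e7 d.P4)) p
  let e1 := Nat.add e1 (Nat.mul e6 d.P0)
  let e2 := Nat.add e2 (Nat.mul e6 d.P1)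
  let e3 := Nat.add e3 (Nat.mul e6 d.P2)
  let e4 := Nat.add e4 (Nat.mul e6 d.P3)
  let e5 := Nat.mod (Nat.add e5 (Nat.mul e6 d.P4)) p
  let e0 := Nat.add e0 (Nat.mul e5 d.P0)
  let e1 := Nat.add e1 (Nat.mul e5 d.P1)
  let e2 := Nat.add e2 (Nat.mul e5 d.P2)
  let e3 := Nat.add e3 (Nat.mul e5 d.P3)
  let e4 := Nat.add e4 (Nat.mul e5 d.P4)
  ⟨Nat.mod e0 p, Nat.mod e1 p, Nat.mod e2 p, Nat.mod e3 p, Nat.mod e4 p⟩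

/-- Binary powering along bits (least significant first). [folklore] -/
def powR (d : RedData) : List Bool → N5 → N5
  | [], _ => ⟨Nat.mod 1 d.p, 0, 0, 0, 0⟩
  | b :: bs, x =>
    let r := powR d bs (mulR d x x)
    cond b (mulR d x r) r

end N5

/-- Binary digits (least significant first), with fuel. [folklore] -/
def bitsF : ℕ → ℕ → List Bool
  | 0, _ => []
  | fuel + 1, n => cond (Nat.beq n 0) [] (Nat.beq (Nat.mod n 2) 1 :: bitsF fuel (Nat.div n 2))

/-- `a ^ e mod m` along bits. [folklore] -/
def powModL (m : ℕ) : List Bool → ℕ → ℕ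
  | [], _ => Nat.mod 1 m
  | b :: bs, a =>
    let r := powModL m bs (Nat.mod (Nat.mul a a) m)
    cond b (Nat.mod (Nat.mul a r) m) r

/-- Inverse modulo a prime `p` by Fermat (`a^{p-2}`). [folklore] -/
def invMod (a p : ℕ) : ℕ := powModL p (bitsF 64 (Nat.sub p 2)) (Nat.mod a p)

/-! ### The reduction of the field polynomial; no-root and irreducibility certificates -/

/-- The field polynomial `f = t⁵ + a₄t⁴ + ⋯ + a₀ ∈ ℤ[t]`, by its coefficients. [folklore] -/
structure FieldPoly where
  /-- coefficient -/ a0 : ℤ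
  /-- coefficient -/ a1 : ℤ
  /-- coefficient -/ a2 : ℤ
  /-- coefficient -/ a3 : ℤ
  /-- coefficient -/ a4 : ℤ

namespace FieldPoly

/-- The reduction data at `p`: `Pᵢ = -aᵢ mod p`. [folklore] -/
def red (f : FieldPoly) (p : ℕ) : RedData :=
  ⟨p, ires (Int.neg f.a0) p, ires (Int.neg f.a1) p, ires (Int.neg f.a2) p, ires (Int.neg f.a3) p,
    ires (Int.neg f.a4) p⟩

/-- `t^p mod (p, f̄)`. [folklore] -/
def tPow (f : FieldPoly) (p : ℕ) : N5 := N5.powR (f.red p) (bitsF 64 p) ⟨0, Nat.mod 1 p, 0, 0, 0⟩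

/-- `w - t mod p` on quintuples. [folklore] -/
def minusT (p : ℕ) (w : N5) : N5 :=
  ⟨w.c0, Nat.mod (Nat.add w.c1 (Nat.sub p (Nat.mod 1 p))) p, w.c2, w.c3, w.c4⟩

/-- `u = 1` in `𝔽_p[t]/(f̄)`. [folklore] -/
def isOne (p : ℕ) (u : N5) : Bool :=
  Nat.beq u.c0 (Nat.mod 1 p) && Nat.beq u.c1 0 && Nat.beq u.c2 0 && Nat.beq u.c3 0 && Nat.beq u.c4 0

/-- **No-root certificate**: `(t^p - t) · s = 1` in `𝔽_p[t]/(f̄)` (so `f̄` has no root in `𝔽_p`,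
`QuinticRing.not_isRoot_of_noRootCert`). [folklore] -/
def noRootCert (f : FieldPoly) (p : ℕ) (s : N5) : Bool :=
  isOne p (N5.mulR (f.red p) (minusT p (f.tPow p)) s)

/-- **Irreducibility certificate** (Rabin): `(t^{p²} - t) · s₂ = 1` in `𝔽_p[t]/(f̄)`
(`QuinticRing.irreducible_poly_of_powCert`). [folklore] -/
def irredCert (f : FieldPoly) (p : ℕ) (s2 : N5) : Bool :=
  let d := f.red p
  let bs := bitsF 64 p
  isOne p (N5.mulR d (minusT p (N5.powR d bs (N5.powR d bs ⟨0, Nat.mod 1 p, 0, 0, 0⟩))) s2)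

end FieldPoly

/-! ### Field data and homomorphisms to `ℤ/m` -/

/-- Horner evaluation of an integer coefficient list (low degree first) at `r` modulo `m`. [folklore] -/
def hornerMod (m r : ℕ) : List ℤ → ℕ
  | [] => 0
  | c :: cs => Nat.mod (Nat.add (Nat.mul (hornerMod m r cs) r) (ires c m)) m

/-- The per-field certificate constants: `f`, the index `D = [Λ : ℤ[g₀]]`, the numerators `P_b`
(`D g_b = P_b(g₀)`, low degree first), the multiplication of the order on coordinates and its values
on pairs of basis vectors. [folklore] -/
structure FieldData where
  /-- the field polynomial -/ f : FieldPoly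
  /-- the index `D` -/ D : ℕ
  /-- numerator of `g₁` -/ P1 : List ℤ
  /-- numerator of `g₂` -/ P2 : List ℤ
  /-- numerator of `g₃` -/ P3 : List ℤ
  /-- numerator of `g₄` -/ P4 : List ℤ
  /-- multiplication on coordinates -/ mul : Z5 → Z5 → Z5
  /-- `tab a b = mul (basis a) (basis b)` -/ tab : ℕ → ℕ → Z5

namespace FieldData

/-- The hom `Λ → ℤ/p` attached to a root `r` when `p ∤ D`: `g₀ ↦ r`, `g_b ↦ P_b(r)/D`. [folklore] -/
def homOfRoot (C : FieldData) (p r : ℕ) : N5 :=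
  let dinv := invMod C.D p
  ⟨Nat.mod r p, Nat.mod (Nat.mul (hornerMod p r C.P1) dinv) p, Nat.mod (Nat.mul (hornerMod p r C.P2) dinv) p,
    Nat.mod (Nat.mul (hornerMod p r C.P3) dinv) p, Nat.mod (Nat.mul (hornerMod p r C.P4) dinv) p⟩

/-- One table identity `h_a h_b ≡ Σ_c T_abc h_c (mod m)`. [folklore] -/
def homEq (C : FieldData) (m : ℕ) (h : N5) (a b : ℕ) : Bool :=
  Nat.beq (Nat.mod (Nat.mul (h.get a) (h.get b)) m) (Z5.evalMod (C.tab a b) h.c0 h.c1 h.c2 h.c3 h.c4 m)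

/-- The identities for a fixed `a` and all `b`. [folklore] -/
def homRow (C : FieldData) (m : ℕ) (h : N5) (a : ℕ) : Bool :=
  C.homEq m h a 0 && C.homEq m h a 1 && C.homEq m h a 2 && C.homEq m h a 3 && C.homEq m h a 4

/-- **`h` is a ring homomorphism `Λ → ℤ/m` on the basis**: all table identities and `Σ h ≡ 1`. [folklore] -/
def isHom (C : FieldData) (m : ℕ) (h : N5) : Bool :=
  Nat.beq (Nat.mod (Nat.add (Nat.add (Nat.add (Nat.add h.c0 h.c1) h.c2) h.c3) h.c4) m) (Nat.mod 1 m) &&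
    C.homRow m h 0 && C.homRow m h 1 && C.homRow m h 2 && C.homRow m h 3 && C.homRow m h 4

/-- **The hom for a prime-root pair**, verified: derived from the root if `p ∤ D`, else the supplied
vector; it must be a reduced homomorphism modulo `p` with first coordinate `r` and pairwise distinct rotations
(then its five rotations are ALL the homomorphisms `Λ → ℤ/p`). [folklore] -/
def homFor (C : FieldData) (p r : ℕ) (ho : Option N5) : Option N5 :=
  let cand : Option N5 := cond (Nat.beq (Nat.mod C.D p) 0) ho (some (C.homOfRoot p r))
  match cand with
  | some h => cond (Nat.beq h.c0 (Nat.mod r p) && C.isHom p h && h.aperiodic && h.ltAll p) (some h) none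
  | none => none

end FieldData

/-! ### Hensel lifting of a simple root and of its homomorphism to `ℤ/p⁵` -/

namespace FieldPoly

/-- `f(x) mod m`. [folklore] -/
def evalMod (f : FieldPoly) (m x : ℕ) : ℕ :=
  hornerMod m x [f.a0, f.a1, f.a2, f.a3, f.a4, 1]

/-- `f'(x) mod m`. [folklore] -/
def derivMod (f : FieldPoly) (m x : ℕ) : ℕ :=
  hornerMod m x [f.a1, Int.mul 2 f.a2, Int.mul 3 f.a3, Int.mul 4 f.a4, 5]

end FieldPoly

/-- One Newton step for an inverse: `y ↦ y (2 - a y) mod m`. [folklore] -/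
def invStep (a m y : ℕ) : ℕ :=
  Nat.mod (Nat.mul y (Nat.mod (Nat.sub (Nat.add m 2) (Nat.mod (Nat.mul a y) m)) m)) m

/-- An inverse of `a` modulo `m = p⁵` from an inverse `y₀` modulo `p` (three Newton steps: precision
`p → p² → p⁴ → p⁸`). [folklore] -/
def invLift (a m y0 : ℕ) : ℕ := invStep a m (invStep a m (invStep a m y0))

/-- One Newton step for a root: `x ↦ x - f(x) f'(x)⁻¹ mod m`. [folklore] -/
def FieldPoly.newtonStep (f : FieldPoly) (p m x : ℕ) : ℕ :=
  let fx := f.evalMod m x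
  let dfx := f.derivMod m x
  let inv := invLift dfx m (invMod dfx p)
  Nat.mod (Nat.sub (Nat.add x m) (Nat.mod (Nat.mul fx inv) m)) m

/-- **Hensel lift of a simple root** `r` of `f̄ mod p` to a root modulo `m = p⁵` (three Newton steps).
[folklore] -/
def FieldPoly.henselRoot (f : FieldPoly) (p m r : ℕ) : ℕ :=
  f.newtonStep p m (f.newtonStep p m (f.newtonStep p m (Nat.mod r p)))

/-- **The homomorphism `Λ → ℤ/p⁵`** above a simple root (when `p ∤ D`): `g₀ ↦ x` (the lifted root),
`g_b ↦ P_b(x)/D`. (Only its verification by `isHom` is used.) [folklore] -/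
def FieldData.hom5OfRoot (C : FieldData) (p r : ℕ) : N5 :=
  let m := Nat.pow p 5
  let x := C.f.henselRoot p m r
  let dinv := invLift C.D m (invMod C.D p)
  ⟨x, Nat.mod (Nat.mul (hornerMod m x C.P1) dinv) m, Nat.mod (Nat.mul (hornerMod m x C.P2) dinv) m,
    Nat.mod (Nat.mul (hornerMod m x C.P3) dinv) m, Nat.mod (Nat.mul (hornerMod m x C.P4) dinv) m⟩

/-! ### Records and their verification -/

/-- **A certificate record** for a prime `p ∉ {11, 241}`:
* `split p r ho h5o β a b neg` — a root `r` (with the explicit homomorphisms modulo `p` and `p⁵` when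
  `p ∣ D`), an element `β ∈ Λ` and the exponents and sign of `N β = ± p⁵ · 11ᵃ · 241ᵇ`;
* `inert p s s2` — the inverses `s` of `t^p - t` and (when `p² ≤ M`) `s₂` of `t^{p²} - t` in
  `𝔽_p[t]/(f̄)`. [folklore] -/
inductive Rec where
  /-- a split prime -/
  | split (p r : ℕ) (ho h5o : Option N5) (β : Z5) (a b : ℕ) (neg : Bool) : Rec
  /-- a non-split prime -/
  | inert (p : ℕ) (s : N5) (s2 : Option N5) : Rec

/-- The prime of a record. [folklore] -/
def Rec.p : Rec → ℕ
  | .split p _ _ _ _ _ _ _ => p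
  | .inert p _ _ => p

/-- `± n` as an integer. [folklore] -/
def signed (neg : Bool) (n : ℕ) : ℤ := cond neg (Int.negOfNat n) (Int.ofNat n)

/-- `h5` reduces to `h` modulo `p`. [folklore] -/
def N5.reducesTo (h5 h : N5) (p : ℕ) : Bool :=
  Nat.beq (Nat.mod h5.c0 p) h.c0 && Nat.beq (Nat.mod h5.c1 p) h.c1 && Nat.beq (Nat.mod h5.c2 p) h.c2 &&
    Nat.beq (Nat.mod h5.c3 p) h.c3 && Nat.beq (Nat.mod h5.c4 p) h.c4

/-- **Verify one record.** Split: the homomorphism `h` modulo `p` (verified, aperiodic), a homomorphism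
`h5` modulo `p⁵` reducing to it (Hensel, or supplied when `p ∣ D`; verified on the table),
`N β = ± p⁵ 11ᵃ 241ᵇ` and `β ∈ ker h5`. Inert: the no-root certificate, and the irreducibility
certificate when `p² ≤ M`. [folklore] -/
def FieldData.checkRec (C : FieldData) (M : ℕ) : Rec → Bool
  | .split p r ho h5o β a b neg =>
    match C.homFor p r ho with
    | none => false
    | some h =>
      let m := Nat.pow p 5
      let h5o' : Option N5 := cond (Nat.beq (Nat.mod C.D p) 0) h5o (some (C.hom5OfRoot p r))
      match h5o' with
      | none => false
      | some h5 =>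
        C.isHom m h5 && h5.reducesTo h p &&
          (Z5.norm C.mul β).isConst (signed neg (Nat.mul (Nat.mul m (Nat.pow 11 a)) (Nat.pow 241 b))) &&
          Nat.beq (Z5.evalMod β h5.c0 h5.c1 h5.c2 h5.c3 h5.c4 m) 0
  | .inert p s s2 =>
    C.f.noRootCert p s &&
      (Nat.blt M (Nat.mul p p) ||
        (!(Nat.beq (Nat.mod C.D p) 0) && (match s2 with | some s2 => C.f.irredCert p s2 | none => false)))

/-! ### The sieve and the main loop -/

/-- The geometric series `Σ_{i<n} 2^{di} = (2^{dn} - 1)/(2^d - 1)` (bits at `0, d, …, d(n-1)`). [folklore] -/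
def geomMask (d n : ℕ) : ℕ :=
  Nat.div (Nat.sub (Nat.pow 2 (Nat.mul d n)) 1) (Nat.sub (Nat.pow 2 d) 1)

/-- The bit mask of the proper multiples `2d, 3d, …, Kd` of `d` (`K = M / d`): the geometric series
with `K - 1` terms shifted left by `2d`. [folklore] -/
def multMask (M d : ℕ) : ℕ :=
  Nat.shiftLeft (geomMask d (Nat.sub (Nat.div M d) 1)) (Nat.mul 2 d)

/-- The mask of the numbers `≤ M` having a divisor `d` with `2 ≤ d < 2 + n`, `d² ≤ M`-ish
(`n` terms). [folklore] -/
def compMaskF (M : ℕ) : ℕ → ℕ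
  | 0 => 0
  | n + 1 => Nat.lor (compMaskF M n) (multMask M (Nat.add n 2))

/-- **The composite mask up to `M`**: bit `n` is set iff `n ≤ M` has a divisor `d` with
`2 ≤ d ≤ 599`, `d < n` — for `n ≤ M < 600²` exactly the composite numbers (and never `0, 1`). [folklore] -/
def compMask (M : ℕ) : ℕ := compMaskF M 598

/-- Process the numbers `n, n+1, …` (`fuel` of them) whose compositeness bits are the low bits of `w`:
every prime `≤ M` other than `11, 241` must be certified by the next record. Returns the unconsumed records,
or `none` on failure. [folklore] -/
def FieldData.scan (C : FieldData) (M : ℕ) : ℕ → ℕ → ℕ → List Rec → Option (List Rec)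
  | 0, _, _, recs => some recs
  | fuel + 1, n, w, recs =>
    let rest := Nat.shiftRight w 1
    cond (Nat.beq (Nat.land w 1) 1 || Nat.blt n 2 || Nat.blt M n || Nat.beq n 11 || Nat.beq n 241)
      (C.scan M fuel (Nat.add n 1) rest recs)
      (match recs with
       | R :: recs' => cond (Nat.beq R.p n && C.checkRec M R) (C.scan M fuel (Nat.add n 1) rest recs') none
       | [] => none)

/-- Process `nb` consecutive blocks of `1024` numbers starting at `lo`, slicing the mask per block
(so that the per-step shifts stay cheap). [folklore] -/
def FieldData.scanBlocks (C : FieldData) (M mask : ℕ) : ℕ → ℕ → List Rec → Option (List Rec)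
  | 0, _, recs => some recs
  | nb + 1, lo, recs =>
    let w := Nat.land (Nat.shiftRight mask lo) (Nat.sub (Nat.pow 2 1024) 1)
    match C.scan M 1024 lo w recs with
    | none => none
    | some recs' => C.scanBlocks M mask nb (Nat.add lo 1024) recs'

/-- **Check the range `[lo, lo + 1024·nb)`** (capped at `M`) against the records `recs` (sorted, all
consumed), reading compositeness from `mask`. [folklore] -/
def FieldData.checkRange (C : FieldData) (M mask lo nb : ℕ) (recs : List Rec) : Bool :=
  match C.scanBlocks M mask nb lo recs with
  | some [] => true
  | _ => false

/-! ### Packed record data -/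

/-- Split off the low 20-bit limb. [folklore] -/
def limb (n : ℕ) : ℕ × ℕ := (Nat.land n 1048575, Nat.shiftRight n 20)

/-- Decode a zig-zag 60-bit signed value (three limbs). [folklore] -/
def decZ (n : ℕ) : ℤ × ℕ :=
  let (l0, n) := limb n
  let (l1, n) := limb n
  let (l2, n) := limb n
  let z := Nat.add l0 (Nat.mul (Nat.add l1 (Nat.mul l2 1048576)) 1048576)
  (cond (Nat.beq (Nat.mod z 2) 1) (Int.negSucc (Nat.div z 2)) (Int.ofNat (Nat.div z 2)), n)

/-- Decode a 100-bit natural (five limbs). [folklore] -/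
def decW (n : ℕ) : ℕ × ℕ :=
  let (l0, n) := limb n
  let (l1, n) := limb n
  let (l2, n) := limb n
  let (l3, n) := limb n
  let (l4, n) := limb n
  (Nat.add l0 (Nat.mul (Nat.add l1 (Nat.mul (Nat.add l2 (Nat.mul (Nat.add l3 (Nat.mul l4 1048576)) 1048576))
    1048576)) 1048576), n)

/-- Decode five naturals (one limb each: a hom modulo `p`). [folklore] -/
def decN5 (n : ℕ) : N5 × ℕ :=
  let (a, n) := limb n
  let (b, n) := limb n
  let (c, n) := limb n
  let (d, n) := limb n
  let (e, n) := limb n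
  (⟨a, b, c, d, e⟩, n)

/-- Decode five wide naturals (a hom modulo `p⁵`). [folklore] -/
def decN5w (n : ℕ) : N5 × ℕ :=
  let (a, n) := decW n
  let (b, n) := decW n
  let (c, n) := decW n
  let (d, n) := decW n
  let (e, n) := decW n
  (⟨a, b, c, d, e⟩, n)

/-- Decode an element of the order (five zig-zag values). [folklore] -/
def decZ5 (n : ℕ) : Z5 × ℕ :=
  let (a, n) := decZ n
  let (b, n) := decZ n
  let (c, n) := decZ n
  let (d, n) := decZ n
  let (e, n) := decZ n
  (⟨a, b, c, d, e⟩, n)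

/-- Decode one record: tag `0`: `p, r, flag, [h, h5], β, a, b, neg`; tag `1`: `p, s, flag, [s₂]`.
[folklore] -/
def decRec (n : ℕ) : Rec × ℕ :=
  let (tag, n) := limb n
  let (p, n) := limb n
  cond (Nat.beq tag 1)
    (let (s, n) := decN5 n
     let (fl, n) := limb n
     cond (Nat.beq fl 1) (let (s2, n) := decN5 n; (Rec.inert p s (some s2), n)) (Rec.inert p s none, n))
    (let (r, n) := limb n
     let (fl, n) := limb n
     let (hs, n) := cond (Nat.beq fl 1)
       (let (h, n) := decN5 n
        let (h5, n) := decN5w n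
        ((some h, some h5), n)) ((none, none), n)
     let (β, n) := decZ5 n
     let (a, n) := limb n
     let (b, n) := limb n
     let (ng, n) := limb n
     (Rec.split p r hs.1 hs.2 β a b (Nat.beq ng 1), n))

/-- Decode records from one blob while it is non-zero (fuel = number of records). [folklore] -/
def decBlob : ℕ → ℕ → List Rec
  | 0, _ => []
  | fuel + 1, n => cond (Nat.beq n 0) [] (let (R, n) := decRec n; R :: decBlob fuel n)

/-- Decode a list of blobs (each holding at most `2048` records). [folklore] -/
def decBlobs : List ℕ → List Rec
  | [] => []
  | b :: bs => decBlob 2048 b ++ decBlobs bs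

end QuinticCert

end Literature.NumberTheory.NumberFields
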